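import Summits.CriticalPhenomena.CardyFormulaZ2.Theorems.CardyFlipRussoVoronoiHubFromSmirnovDefs
import Literature.Analysis.Complex.InjectiveHolomorphic

/-!
# Stub `stub_conformalTransport` (S3), profile clause — line `moebius-exact-delaunay-dilation-ward`,
# crux `VoronoiHubFromSmirnov` (stmt-CriticalPhenomena-6433)

Registered helper `exists_admissibleDensity_eq_norm_deriv_sq` of the conformal-transport stub
(Benjamini–Schramm 1998, Thm 2.1, the pulled-back intensity `|h′|²`): for `h` holomorphic and
injective on an open `U ⊇ closure Ω` there is an ADMISSIBLE intensity profile `ρ` (smooth,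
everywhere positive, `ρ - 1` compactly supported) that equals `‖deriv h‖ ^ 2` on an open
neighbourhood of `closure Ω`.

Proof.  `closure Ω` is compact (`R.isBounded`); take a smooth cutoff `χ : ℂ → [0,1]` with compact
`tsupport χ ⊆ U` and `χ = 1` near `closure Ω` (smooth Urysohn lemma on the model space,
`exists_contMDiffMap_zero_one_nhds_of_isClosed`), and put `ρ := χ ‖h′‖² + (1 - χ)`.  The function
`‖h′‖²` is real-smooth on `U` (`h′` is holomorphic there) and positive on `U` (an injective
holomorphic map has nowhere vanishing derivative, `SCV.deriv_ne_zero_of_injOn`); `χ ‖h′‖²` is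
globally smooth because it vanishes identically off `tsupport χ ⊆ U`; `ρ - 1 = χ (‖h′‖² - 1)` has
compact support; and `ρ > 0` as a convex combination of `‖h′‖² > 0` (where `χ ≠ 0`, inside `U`)
and `1`.  All [folklore].
-/

noncomputable section

namespace Summit.CriticalPhenomena.CardyFormulaZ2.Cruxes.VoronoiHubFromSmirnov.MoebiusExactDelaunayDilationWard

open scoped Topology Manifold ContDiff
open Filter Set
open Literature.Probability.RandomPlanarGeometry

/-- **Smooth cutoff `≡ 1` near a compact set** (finite-dimensional smooth Urysohn lemma): for a
compact `K` inside an open `O ⊆ ℂ` there is a smooth `χ : ℂ → [0, 1]` with compact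
`tsupport χ ⊆ O` and `χ = 1` on a neighbourhood of `K`. [folklore] -/
theorem ct_exists_cutoff {K O : Set ℂ} (hK : IsCompact K) (hO : IsOpen O) (hKO : K ⊆ O) :
    ∃ χ : ℂ → ℝ, ContDiff ℝ (⊤ : ℕ∞) χ ∧ HasCompactSupport χ ∧ tsupport χ ⊆ O ∧
      (∀ z, χ z ∈ Icc (0 : ℝ) 1) ∧ ∀ᶠ z in 𝓝ˢ K, χ z = 1 := by
  obtain ⟨L, hL, hKL, hLO⟩ := exists_compact_between hK hO hKO
  obtain ⟨f, hf0, hf1, hf01⟩ :=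
    exists_contMDiffMap_zero_one_nhds_of_isClosed (I := 𝓘(ℝ, ℂ)) (M := ℂ) (n := (⊤ : ℕ∞))
      isOpen_interior.isClosed_compl hK.isClosed (disjoint_compl_left_iff_subset.2 hKL)
  have hsupp : Function.support (f : ℂ → ℝ) ⊆ interior L := fun x hx => by
    by_contra hx'
    exact hx (hf0.self_of_nhdsSet x hx')
  have htsupp : tsupport (f : ℂ → ℝ) ⊆ L :=
    (closure_mono hsupp).trans (closure_minimal interior_subset hL.isClosed)
  exact ⟨f, contMDiff_iff_contDiff.1 f.contMDiff,
    hL.of_isClosed_subset (isClosed_tsupport _) htsupp, htsupp.trans hLO, hf01, hf1⟩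

/-- **Localisation is globally smooth**: if `g` is `Cⁿ` on an open `O` and `χ` is `Cⁿ` with
`tsupport χ ⊆ O`, then `χ · g` (with `g` arbitrary off `O`) is `Cⁿ` on all of `ℂ` — near `O` a
product of `Cⁿ` functions, elsewhere identically `0`. [folklore] -/
theorem ct_contDiff_cutoff_mul {n : WithTop ℕ∞} {χ g : ℂ → ℝ} {O : Set ℂ} (hO : IsOpen O)
    (hχ : ContDiff ℝ n χ) (hχO : tsupport χ ⊆ O) (hg : ContDiffOn ℝ n g O) :
    ContDiff ℝ n fun z => χ z * g z := by
  rw [contDiff_iff_contDiffAt]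
  intro z
  by_cases hz : z ∈ O
  · exact hχ.contDiffAt.mul (hg.contDiffAt (hO.mem_nhds hz))
  · have hz' : z ∉ tsupport χ := fun h => hz (hχO h)
    have h0 : (fun w => χ w * g w) =ᶠ[𝓝 z] fun _ => 0 := by
      filter_upwards [notMem_tsupport_iff_eventuallyEq.1 hz'] with w hw
      simp [hw]
    exact contDiffAt_const.congr_of_eventuallyEq h0

/-- `‖h′‖²` is real-smooth on an open set where `h` is holomorphic (`h′` is holomorphic there,
and `‖·‖²` is smooth on the real inner product space `ℂ`). [folklore] -/
theorem ct_contDiffOn_norm_deriv_sq {h : ℂ → ℂ} {U : Set ℂ} (hU : IsOpen U)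
    (hd : DifferentiableOn ℂ h U) :
    ContDiffOn ℝ (⊤ : ℕ∞) (fun z => ‖deriv h z‖ ^ 2) U := by
  have h1 : ContDiffOn ℂ (⊤ : ℕ∞) (deriv h) U := (hd.deriv hU).contDiffOn hU
  exact (h1.restrict_scalars ℝ).norm_sq ℝ

/-- **Profile clause of the conformal transport (S3)**: for `h` holomorphic and injective on an
open `U ⊇ closure Ω` there is an admissible intensity profile `ρ` — smooth, everywhere positive,
`ρ - 1` compactly supported — equal to `‖deriv h‖ ^ 2` on an open neighbourhood of `closure Ω`
(the configuration-coordinate intensity of the homogeneous nuclei of `h(U)` pulled back by `h`,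
Benjamini–Schramm 1998 Thm 2.1, cut off smoothly to `1` away from `closure Ω`). [folklore] -/
theorem exists_admissibleDensity_eq_norm_deriv_sq :
    ∀ (R : ConformalRectangle) (h : ℂ → ℂ) (U : Set ℂ), IsOpen U → closure R.carrier ⊆ U →
      DifferentiableOn ℂ h U → InjOn h U →
        ∃ ρ, AdmissibleDensity ρ ∧ ∃ V, IsOpen V ∧ closure R.carrier ⊆ V ∧
          ∀ z ∈ V, ρ z = ‖deriv h z‖ ^ 2 := by
  intro R h U hU hRU hd hi
  have hK : IsCompact (closure R.carrier) := R.isBounded.isCompact_closure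
  obtain ⟨χ, hχ, hχc, hχU, hχ01, hχ1⟩ := ct_exists_cutoff hK hU hRU
  set g : ℂ → ℝ := fun z => ‖deriv h z‖ ^ 2 with hg
  have hgU : ContDiffOn ℝ (⊤ : ℕ∞) g U := ct_contDiffOn_norm_deriv_sq hU hd
  have hgpos : ∀ z ∈ U, 0 < g z := fun z hz =>
    pow_pos (norm_pos_iff.2
      (Literature.Analysis.Complex.SCV.deriv_ne_zero_of_injOn hd hU hi hz)) 2
  refine ⟨fun z => χ z * g z + (1 - χ z), ⟨?_, ?_, ?_⟩, interior {w | χ w = 1}, isOpen_interior,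
    subset_interior_iff_mem_nhdsSet.2 hχ1, fun z hz => ?_⟩
  · exact (ct_contDiff_cutoff_mul hU hχ hχU hgU).add (contDiff_const.sub hχ)
  · have heq : (fun z => χ z * g z + (1 - χ z) - 1) = fun z => χ z * (g z - 1) := by
      funext z
      ring
    rw [heq]
    exact hχc.mul_right (f' := fun z => g z - 1)
  · intro z
    by_cases hz : χ z = 0
    · simp [hz]
    · have hzU : z ∈ U := hχU (subset_tsupport _ hz)
      have h01 := hχ01 z
      have hpos : 0 < χ z := lt_of_le_of_ne h01.1 (Ne.symm hz)
      nlinarith [hgpos z hzU, h01.2, mul_pos hpos (hgpos z hzU)]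
  · have hz1 : χ z = 1 := interior_subset (s := {w | χ w = 1}) hz
    simp [hz1, hg]

end Summit.CriticalPhenomena.CardyFormulaZ2.Cruxes.VoronoiHubFromSmirnov.MoebiusExactDelaunayDilationWard

end
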